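import Summits.RiemannHypothesis.RiemannHypothesis.Theorems.WeilTwoPrimeDeflC83XBase
import Literature.NumberTheory.LFunctions.WeilBlockRows
import HarnessLib

/-!
# Deflated two-prime certificate C83X: rows 24–31 of the even check `D C = I`

`WeilCert.checkDCRow 0` for certificate C83X, by `decide +kernel`. Pure proof file.
-/

set_option linter.dupNamespace false

noncomputable section

namespace Summit.RiemannHypothesis.RiemannHypothesis.Theorems.EvenWinsBeyondArch

open Literature.NumberTheory.LFunctions

set_option maxHeartbeats 0 in
/-- Kernel check of row 24 of the even `D C = I` (certificate C83X). [folklore] -/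
theorem checkDCRow0_24_weilCertDeflC83X : weilCertDeflC83XBase.checkDCRow 0 24 = true := by
  decide +kernel

set_option maxHeartbeats 0 in
/-- Kernel check of row 25 of the even `D C = I` (certificate C83X). [folklore] -/
theorem checkDCRow0_25_weilCertDeflC83X : weilCertDeflC83XBase.checkDCRow 0 25 = true := by
  decide +kernel

set_option maxHeartbeats 0 in
/-- Kernel check of row 26 of the even `D C = I` (certificate C83X). [folklore] -/
theorem checkDCRow0_26_weilCertDeflC83X : weilCertDeflC83XBase.checkDCRow 0 26 = true := by
  decide +kernel

set_option maxHeartbeats 0 in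
/-- Kernel check of row 27 of the even `D C = I` (certificate C83X). [folklore] -/
theorem checkDCRow0_27_weilCertDeflC83X : weilCertDeflC83XBase.checkDCRow 0 27 = true := by
  decide +kernel

set_option maxHeartbeats 0 in
/-- Kernel check of row 28 of the even `D C = I` (certificate C83X). [folklore] -/
theorem checkDCRow0_28_weilCertDeflC83X : weilCertDeflC83XBase.checkDCRow 0 28 = true := by
  decide +kernel

set_option maxHeartbeats 0 in
/-- Kernel check of row 29 of the even `D C = I` (certificate C83X). [folklore] -/
theorem checkDCRow0_29_weilCertDeflC83X : weilCertDeflC83XBase.checkDCRow 0 29 = true := by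
  decide +kernel

set_option maxHeartbeats 0 in
/-- Kernel check of row 30 of the even `D C = I` (certificate C83X). [folklore] -/
theorem checkDCRow0_30_weilCertDeflC83X : weilCertDeflC83XBase.checkDCRow 0 30 = true := by
  decide +kernel

set_option maxHeartbeats 0 in
/-- Kernel check of row 31 of the even `D C = I` (certificate C83X). [folklore] -/
theorem checkDCRow0_31_weilCertDeflC83X : weilCertDeflC83XBase.checkDCRow 0 31 = true := by
  decide +kernel


end Summit.RiemannHypothesis.RiemannHypothesis.Theorems.EvenWinsBeyondArch
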